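import Summits.QuantumAdvantage.QuantumAdvantage.Theorems.CubicForrelationNearExactIsExactFlatL1

/-!
# Crux `CubicForrelation.NearExactIsExact` (stmt-QuantumAdvantage-14043) — the Fourier SUPPORT of a sign pattern that is quadratic of rank `≤ 2`
  along a flat (general `n`)

Certificate seat `b2b-cforr-cert` (gen 18).  HONEST FRAMING: infrastructure about `±1` patterns on cosets of `𝔽₂ⁿ` (the support companion of the
`L¹` engine `fl1_flat_l1`), input of the type-O × level-≥6 analysis at `Φ = 932/1024` on 12 bits — NOT summit progress.

`fl1_flat_supp`: `S = x₁ ⊕ V₀` a coset (`V₀ ∋ 0` `⊕`-closed), `e = ±1` on `S`; if every parametrised 3-flat sum of `e` inside `S` is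
`≡ 0 (mod 4)` and every parametrised 4-flat sum is `≡ 0 (mod 8)`, then the transform of `A = e·1_S` is supported on at most `4·2ⁿ/#V₀` points:
the radical `R` of the relative form has `4·#R ≥ #V₀` (`fr_radical_large`) and consists of periods up to sign, and `#supp(Â)·#R ≤ 2ⁿ`
(`fp_card_supp_mul_le`).  Verbatim the construction of `fl1_flat_l1` (gen 6) with the support bound in place of Cauchy–Schwarz.

References: R. O'Donnell (2014) §3.3; MacWilliams–Sloane (1977) Ch. 15 §2.  Everything below is proved from Mathlib and the tree; axioms are
the standard three.
-/

set_option linter.dupNamespace false -- D-0017: single-problem summit ⇒ `QuantumAdvantage.QuantumAdvantage` by design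

noncomputable section

namespace Summit.QuantumAdvantage.QuantumAdvantage.Theorems.CubicForrelation.NearExactIsExact

open Finset
open Literature.Computability.QuantumComplexity
open Literature.Computability.QuantumComplexity.BuzetChailloux (bxor zeroVec bxor_bxor_cancel_left bxor_zeroVec zeroVec_bxor bxor_comm
  bxor_self)
open Literature.Computability.QuantumComplexity.DerivativeWalsh (W)

variable {n : ℕ}

/-- **Support bound for a rank-`≤ 2` quadratic sign pattern on a coset** (see the module docstring): under (H3)/(H4),
`#supp(W(e·1_S)) · #V₀ ≤ 4·2ⁿ`. [this work] -/
theorem fl1_flat_supp (V₀ S : Finset (Fin n → Bool)) (x₁ : Fin n → Bool) (h0 : zeroVec ∈ V₀)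
    (hadd : ∀ a ∈ V₀, ∀ b ∈ V₀, bxor a b ∈ V₀) (hS : S = V₀.image (bxor x₁)) (e : (Fin n → Bool) → ℤ)
    (he : ∀ x ∈ S, e x = 1 ∨ e x = -1)
    (H3 : ∀ x ∈ S, ∀ a b c : Fin n → Bool, a ∈ V₀ → b ∈ V₀ → c ∈ V₀ →
      (4 : ℤ) ∣ ∑ ε : Fin 3 → Bool, e (fun j => x j ^^ decide (Odd #(univ.filter fun i =>
        ε i && (![a, b, c] : Fin 3 → Fin n → Bool) i j))))
    (H4 : ∀ x ∈ S, ∀ a₀ a₁ a₂ a₃ : Fin n → Bool, a₀ ∈ V₀ → a₁ ∈ V₀ → a₂ ∈ V₀ → a₃ ∈ V₀ →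
      (8 : ℤ) ∣ ∑ ε : Fin 4 → Bool, e (fun j => x j ^^ decide (Odd #(univ.filter fun i =>
        ε i && (![a₀, a₁, a₂, a₃] : Fin 4 → Fin n → Bool) i j)))) :
    #(univ.filter fun y : Fin n → Bool => W (fun x => if x ∈ S then (e x : ℝ) else 0) y ≠ 0) * #V₀ ≤ 4 * 2 ^ n := by
  classical
  have hx₁ : x₁ ∈ S := by rw [hS]; exact mem_image.2 ⟨zeroVec, h0, bxor_zeroVec x₁⟩
  set h : (Fin n → Bool) → Bool := fun x => decide (e x = -1) with hh
  have heh : ∀ x ∈ S, e x = sZ (h x) := fun x hx => fl1_sZ_decide (he x hx)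
  have hPV : ∀ x, x ∈ S → ∀ a ∈ V₀, bxor x a ∈ S := fun x hx a ha => fl1_coset_vadd hadd hS hx ha
  have hVP : ∀ x, x ∈ S → bxor x₁ x ∈ V₀ := fun x hx => fl1_coset_diff hS hx
  -- the hypotheses in sign form
  have H3' : ∀ x, x ∈ S → ∀ a b c : Fin n → Bool, a ∈ V₀ → b ∈ V₀ → c ∈ V₀ →
      (4 : ℤ) ∣ ∑ ε : Fin 3 → Bool, sZ (h (fun j => x j ^^ decide (Odd #(univ.filter fun i =>
        ε i && (![a, b, c] : Fin 3 → Fin n → Bool) i j)))) := by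
    intro x hx a b c ha hb hc
    have key := H3 x hx a b c ha hb hc
    rwa [sum_congr rfl fun ε _ => heh _ (fr_mem_flatPt3 V₀ h0 (· ∈ S) hPV hx ![a, b, c]
      (fun i => by fin_cases i <;> assumption) ε)] at key
  have H4' : ∀ x, x ∈ S → ∀ a₀ a₁ a₂ a₃ : Fin n → Bool, a₀ ∈ V₀ → a₁ ∈ V₀ → a₂ ∈ V₀ → a₃ ∈ V₀ →
      (8 : ℤ) ∣ ∑ ε : Fin 4 → Bool, sZ (h (fun j => x j ^^ decide (Odd #(univ.filter fun i =>
        ε i && (![a₀, a₁, a₂, a₃] : Fin 4 → Fin n → Bool) i j)))) := by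
    intro x hx a₀ a₁ a₂ a₃ ha₀ ha₁ ha₂ ha₃
    have key := H4 x hx a₀ a₁ a₂ a₃ ha₀ ha₁ ha₂ ha₃
    rwa [sum_congr rfl fun ε _ => heh _ (fr_mem_flatPt4 V₀ h0 (· ∈ S) hPV hx ![a₀, a₁, a₂, a₃]
      (fun i => by fin_cases i <;> assumption) ε)] at key
  -- the radical
  set R := V₀.filter (fun a => ∀ b ∈ V₀, (h x₁ ^^ h (bxor x₁ a) ^^ h (bxor x₁ b) ^^ h (bxor (bxor x₁ a) b)) = false) with hR
  have hsd := fr_hsd V₀ (· ∈ S) x₁ hx₁ hVP h H3'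
  have hlarge : #V₀ ≤ 4 * #R := fr_radical_large V₀ (· ∈ S) x₁ h hadd hx₁ hPV hVP H3' H4'
  have hR0 : zeroVec ∈ R := fr_radical_zero_mem V₀ x₁ h h0
  have hRadd : ∀ a ∈ R, ∀ b ∈ R, bxor a b ∈ R := fr_radical_add V₀ (· ∈ S) x₁ h hx₁ hPV hadd hsd
  -- periods up to sign of `A = e·1_S`
  set A : (Fin n → Bool) → ℝ := fun x => if x ∈ S then (e x : ℝ) else 0 with hA
  have hA1 : ∀ x ∈ S, A x = 1 ∨ A x = -1 := by
    intro x hx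
    simp only [A, if_pos hx]
    rcases he x hx with h1 | h1 <;> rw [h1] <;> norm_num
  have hA0 : ∀ x, x ∉ S → A x = 0 := fun x hx => by simp only [A, if_neg hx]
  have hper : ∀ a ∈ R, ∃ c : ℝ, (c = 1 ∨ c = -1) ∧ ∀ x, A (bxor x a) = c * A x := by
    intro a ha
    have haV : a ∈ V₀ := (mem_filter.1 ha).1
    refine ⟨((sZ (h x₁ ^^ h (bxor x₁ a)) : ℤ) : ℝ), ?_, fun x => ?_⟩
    · rcases tp_sZ_cases (h x₁ ^^ h (bxor x₁ a)) with hc | hc <;> rw [hc] <;> norm_num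
    · by_cases hx : x ∈ S
      · have hxa : bxor x a ∈ S := hPV x hx a haV
        simp only [A, if_pos hx, if_pos hxa]
        rw [heh _ hxa, heh _ hx, fr_radical_period V₀ (· ∈ S) x₁ h hx₁ hVP hsd ha hx]
        rw [tp_sZ_cast, tp_sZ_cast, tp_sZ_cast, signOf_xor]
        ring
      · have hxa : bxor x a ∉ S := fl1_coset_out' hadd hS hx haV
        simp only [A, if_neg hx, if_neg hxa, mul_zero]
  -- support bound and counting
  have hF := fp_card_supp_mul_le A R hR0 hRadd hper
  calc #(univ.filter fun y : Fin n → Bool => W A y ≠ 0) * #V₀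
      ≤ #(univ.filter fun y : Fin n → Bool => W A y ≠ 0) * (4 * #R) := Nat.mul_le_mul_left _ hlarge
    _ = 4 * (#(univ.filter fun y : Fin n → Bool => W A y ≠ 0) * #R) := by ring
    _ ≤ 4 * 2 ^ n := Nat.mul_le_mul_left _ hF

end Summit.QuantumAdvantage.QuantumAdvantage.Theorems.CubicForrelation.NearExactIsExact

end
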